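import Literature.Probability.FitznerVanDerHofstad2017.NoblePeelEntryOne
import HarnessLib

/-!
# [FvdH17] §5.1 / §6.1 — the primed row `(0,0)` of `(A^ι)'` and `(A^{ι,*})'`: closed form and tier-P majorant

Source: R. Fitzner, R. van der Hofstad, *Mean-field behavior for nearest-neighbor percolation in `d > 10`*,
Electron. J. Probab. **22** (2017) no. 43 [FvdH17]; extended version arXiv:1506.07977v2, §5.1 "Elements of the
bounds" (p. 49) `(A^ι)_{a,b} = sup_v Σ_{ι,x,y} A^{ι,a,b}(0,v,x,y)`, `(A^{ι,*})_{a,b}` likewise; App. B Table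
"definition of `A^{ι,a,b}(0,v,x,y)`", row `a = b = 0 (⇒ x = y, v = 0 ⇒ v ≠ y, x ≠ e)` (p. 75); §6.1, display
(Bound-Xi-case-abZero) (p. 59): with the start `u = w = 0` the row `(0,0)` is read as `T_{1̲,1,1}(e_ι, x, 0)` —
the PRIMED families `blockAiota'`, `blockAiotaSt'` and matrices `matAiota'`, `matAiotaSt'` of `NobleBlocksPrime`.

`NobleElementsClosedForms` summed out the Kronecker deltas of the row `(0,0)` for the landed `matAiota`,
`matAiotaSt` and for the primed double-open elements `matAbarIota'`, `matAbarIotaSt'`.  This module does the same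
~30-line collapse for the two remaining primed matrices (node N76-EXL, cell "AiotaNonRep[0,0]" of the claim table:
the matrix-object closed form was not in the tree):

* §1 `matAiota'_zero_zero`, `matAiotaSt'_zero_zero` — **`(A^{ι})'_{0,0} = (A^{ι,*})'_{0,0} =
  Σ_x Σ_κ (1−δ_{0,x})(1−δ_{x,e_κ}) T_{1̲,1,1}(e_κ,x,0)`** (the supremum over `v` is attained at `v = 0`, the inner
  `y`-sum is the diagonal term `y = x`);
* `matAiota'_zero_zero_eq_matAbarIota'`, `matAiotaSt'_zero_zero_eq_matAbarIotaSt'`, `matAiotaSt'_zero_zero_eq_matAiota'`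
  — in the row `(0,0)` all four primed elements are the same letter sum (so every estimate of that letter sum, e.g.
  a peel/slot bound for `(Ā^{ι,*})'_{0,0}`, prices `(A^{ι,*})'_{0,0}` verbatim).

* §2 `perc_matAiota'_zero_zero_le_peel`, `perc_matAiotaSt'_zero_zero_le_peel` — for the percolation letter table, in
  tier P: **`(A^{ι})'_{0,0}, (A^{ι,*})'_{0,0} ≤ ofReal (2d · p · bubbleSlotR p Γ̄₂ 1 1 M N R₁ R₂)`** (the landed
  `NoblePeelEntryOne.perc_tsum_sum_kdc_T_eqOne_ge_ge_stepVec_le_peel`: the exact first leg peels off at the price `p`,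
  §4.2 (4.17) and the sentence after it (p. 36), §6.1 after (6.4) (p. 58); the remaining bubble at the unit-vector
  endpoint is a [NoBLE17] §5.3.2 (5.40) slot, PTRF **169** (2017) p. 1098), `d ≥ 2`, `p < p_c(d)`, `1 ≤ M`.

§1 holds for any letter table `L : Letters d`, any `d` (equalities in `ℝ≥0∞`); §2 is unconditional in `p < p_c(d)`;
no numeral is evaluated and nothing is cited as a hypothesis — kernel-proved statements about the landed definitions.
-/

noncomputable section

namespace Literature.Probability.FitznerVanDerHofstad2017.NobleBlocks

open Literature.Probability.LatticeModels Literature.Probability.Percolation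
open Literature.Probability.FitznerVanDerHofstad2017.BlockSummation
open Literature.Barriers.CriticalPhenomena
open scoped BigOperators ENNReal Matrix

variable {d : ℕ}

/-! ## §1. Closed forms (any letter table) -/

section ClosedForms

variable (L : Letters d)

/-- `(A^{ι})'_{0,0} = Σ_x Σ_κ (1−δ_{0,x})(1−δ_{x,e_κ}) T_{1̲,1,1}(e_κ,x,0)` — the primed element of `NobleBlocksPrime`
(§6.1 reading of the row `(0,0)`), Kronecker deltas summed out, supremum over `v` attained at `v = 0`.
[cite: FitznerVanDerHofstad2017, §6.1 Case a = 0, b = 0, display (Bound-Xi-case-abZero) (arXiv:1506.07977v2 p. 59); App. B Table "definition of A^{ι,a,b}(0,v,x,y)", row (0,0) (p. 75); §5.1 "Elements of the bounds" (p. 49)] -/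
theorem matAiota'_zero_zero : matAiota' L 0 0 =
    ∑' x, ∑ κ : Fin d × Bool, kdc 0 x * kdc x (stepVec κ) * L.T (.eq 1) (.ge 1) (.ge 1) (stepVec κ) x 0 := by
  have h : ∀ κ v x y, blockAiota' L κ 0 0 0 v x y =
      kd x y * kd v 0 * kdc v y * kdc x (stepVec κ) * L.T (.eq 1) (.ge 1) (.ge 1) (stepVec κ) x 0 := fun κ v x y => by
    rw [blockAiota', ofBase_zero, blockAiota₀'_zero_zero]
  rw [matAiota', matB_apply,
    iSup_eq_apply_zero (fun v => ∑' x, ∑' y, ∑ κ, blockAiota' L κ 0 0 0 v x y) fun v hv => by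
      simp [h, kd_of_ne hv]]
  refine tsum_congr fun x => ?_
  rw [tsum_eq_single x fun y hy => by simp [h, kd_of_ne (Ne.symm hy)]]
  simp [h]

/-- `(A^{ι,*})'_{0,0} = Σ_x Σ_κ (1−δ_{0,x})(1−δ_{x,e_κ}) T_{1̲,1,1}(e_κ,x,0)` — the primed non-repulsive element
(row `b = 0` is repulsive in both tables; §6.1 reading of the row `(0,0)`).
[cite: FitznerVanDerHofstad2017, §6.1 Case a = 0, b = 0, display (Bound-Xi-case-abZero) (arXiv:1506.07977v2 p. 59); App. B, sentence after Table "definition of A^{ι,a,b}" (p. 75); §5.1 "Elements of the bounds" (p. 49)] -/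
theorem matAiotaSt'_zero_zero : matAiotaSt' L 0 0 =
    ∑' x, ∑ κ : Fin d × Bool, kdc 0 x * kdc x (stepVec κ) * L.T (.eq 1) (.ge 1) (.ge 1) (stepVec κ) x 0 := by
  have h : ∀ κ v x y, blockAiotaSt' L κ 0 0 0 v x y =
      kd x y * kd v 0 * kdc v y * kdc x (stepVec κ) * L.T (.eq 1) (.ge 1) (.ge 1) (stepVec κ) x 0 := fun κ v x y => by
    rw [blockAiotaSt', ofBase_zero, blockAiotaSt₀'_zero_zero]
  rw [matAiotaSt', matB_apply,
    iSup_eq_apply_zero (fun v => ∑' x, ∑' y, ∑ κ, blockAiotaSt' L κ 0 0 0 v x y) fun v hv => by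
      simp [h, kd_of_ne hv]]
  refine tsum_congr fun x => ?_
  rw [tsum_eq_single x fun y hy => by simp [h, kd_of_ne (Ne.symm hy)]]
  simp [h]

/-- In the row `(0,0)` the primed `A^{ι}` element equals the primed double-open one: `(A^{ι})'_{0,0} = (Ā^{ι})'_{0,0}`
(`Ā^{ι,a,0} = A^{ι,a,0}`, App. B p. 78, and both suprema collapse).
[cite: FitznerVanDerHofstad2017, App. B display "double-open triangle Ā^{ι,a,b}" (arXiv:1506.07977v2 p. 78); §6.1 (p. 59); §5.1 (p. 49)] -/
theorem matAiota'_zero_zero_eq_matAbarIota' : matAiota' L 0 0 = matAbarIota' L 0 0 := by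
  rw [matAiota'_zero_zero, matAbarIota'_zero_zero]

/-- `(A^{ι,*})'_{0,0} = (Ā^{ι,*})'_{0,0}`. [cite: FitznerVanDerHofstad2017, §5.1 Table "Ā^{ι,a,b,*}" (arXiv:1506.07977v2 p. 47); App. B (p. 78); §6.1 (p. 59)] -/
theorem matAiotaSt'_zero_zero_eq_matAbarIotaSt' : matAiotaSt' L 0 0 = matAbarIotaSt' L 0 0 := by
  rw [matAiotaSt'_zero_zero, matAbarIotaSt'_zero_zero]

/-- `(A^{ι,*})'_{0,0} = (A^{ι})'_{0,0}` (row `b = 0` is repulsive in both tables).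
[cite: FitznerVanDerHofstad2017, App. B, sentence after Table "definition of A^{ι,a,b}" (arXiv:1506.07977v2 p. 75); §6.1 (p. 59)] -/
theorem matAiotaSt'_zero_zero_eq_matAiota' : matAiotaSt' L 0 0 = matAiota' L 0 0 := by
  rw [matAiotaSt'_zero_zero, matAiota'_zero_zero]

end ClosedForms

/-! ## §2. The percolation instance in tier P (peel of the exact first leg + unit-endpoint slot) -/

section Peel

variable (p : unitInterval)

/-- **`(A^{ι})'_{0,0}` in tier P**: `(A^{ι})'_{0,0} ≤ 2d · p · bubbleSlotR p Γ̄₂ 1 1 M N R₁ R₂`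
(`matAiota'_zero_zero` + the peel of the exact first leg + the unit-endpoint (5.40) slot).
[cite: FitznerVanDerHofstad2017, §6.1 Case a = 0, b = 0 (arXiv:1506.07977v2 p. 59); §5.1 "Elements of the bounds" (p. 49); §4.2 (4.17) and the sentence after it (p. 36); §6.1 after (6.4) (p. 58)]
[cite: FitznerVanDerHofstad2016NoBLE, §5.3.2 (5.40) (PTRF 169 (2017) p. 1098)] -/
theorem perc_matAiota'_zero_zero_le_peel (hd : 2 ≤ d) (hp : p < criticalProbI d) {M : ℕ} (hM : 1 ≤ M)
    {N : ℕ → ℕ} (hN : ∀ L (ι : Fin d × Bool), (trailWordsTo d L (stepVec ι : Site d)).card ≤ N L) {R₁ R₂ : ℝ}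
    (hR₁ : IsRemKernelConst d [M] (Set.range fun ι : Fin d × Bool => (stepVec ι : Site d)) R₁)
    (hR₂ : IsRemKernelConst d [M - 1, 1] (Set.range fun ι : Fin d × Bool => (stepVec ι : Site d)) R₂) :
    matAiota' (Letters.perc d p) 0 0 ≤
      ENNReal.ofReal (((2 * d : ℕ) : ℝ) * (p : ℝ) * bubbleSlotR p (nobleSup2 d p) 1 1 M N R₁ R₂) := by
  rw [matAiota'_zero_zero]
  exact perc_tsum_sum_kdc_T_eqOne_ge_ge_stepVec_le_peel p hd hp hM hN hR₁ hR₂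

/-- **`(A^{ι,*})'_{0,0}` in tier P**: the primed non-repulsive element has the same closed form
(`matAiotaSt'_zero_zero`), hence the same majorant.
[cite: FitznerVanDerHofstad2017, §6.1 Case a = 0, b = 0 (arXiv:1506.07977v2 p. 59); App. B, sentence after Table "definition of A^{ι,a,b}" (p. 75); §5.1 (p. 49); §6.1 after (6.4) (p. 58)]
[cite: FitznerVanDerHofstad2016NoBLE, §5.3.2 (5.40) (PTRF 169 (2017) p. 1098)] -/
theorem perc_matAiotaSt'_zero_zero_le_peel (hd : 2 ≤ d) (hp : p < criticalProbI d) {M : ℕ} (hM : 1 ≤ M)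
    {N : ℕ → ℕ} (hN : ∀ L (ι : Fin d × Bool), (trailWordsTo d L (stepVec ι : Site d)).card ≤ N L) {R₁ R₂ : ℝ}
    (hR₁ : IsRemKernelConst d [M] (Set.range fun ι : Fin d × Bool => (stepVec ι : Site d)) R₁)
    (hR₂ : IsRemKernelConst d [M - 1, 1] (Set.range fun ι : Fin d × Bool => (stepVec ι : Site d)) R₂) :
    matAiotaSt' (Letters.perc d p) 0 0 ≤
      ENNReal.ofReal (((2 * d : ℕ) : ℝ) * (p : ℝ) * bubbleSlotR p (nobleSup2 d p) 1 1 M N R₁ R₂) := by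
  rw [matAiotaSt'_zero_zero]
  exact perc_tsum_sum_kdc_T_eqOne_ge_ge_stepVec_le_peel p hd hp hM hN hR₁ hR₂

end Peel

end Literature.Probability.FitznerVanDerHofstad2017.NobleBlocks

end
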